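import Summits.NavierStokesRegularity.NavierStokesRegularity.Theses.TautLoopKelvin
import Summits.NavierStokesRegularity.NavierStokesRegularity.Theorems.TautLoopKelvinTautCompressionIntegrableStubNearTaut
import Summits.NavierStokesRegularity.NavierStokesRegularity.Theorems.TautLoopKelvinTautCompressionIntegrableStubGradientBound
import Summits.NavierStokesRegularity.NavierStokesRegularity.Theorems.HodographBetchovFastClassSqueezeOfBounded
import HarnessLib

/-!
# `TautLoopKelvin.TautCompressionIntegrable` (stmt-NavierStokesRegularity-15248), line `birth`:
  the REGULAR regime in full, and the identification of the two singular regimes with the open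
  items `NoTypeIBlowup` (stmt-1217) / `NoTypeII` (stmt-0056)

The crux K1 asks, for every classical solution `u` of unforced Navier–Stokes on `ℝ³ × [0,T)` that is
Leray–Hopf on `[0,T]` from a rapidly decaying datum and every level `g`, for a measurable majorant
`Φ` of the near-taut compression rate `Λ_g(s)` on `(0,T)` with `∫⁻_(0,T) Φ⁺ ≤ M < ∞`.

This file closes the part of K1 that holds for an honest reason and names the rest:

* `conclusion_of_hasSmoothExtensionPast` — **if `u` extends classically past `T`, the conclusion of
  K1 holds for `u` at every level**, with `Φ :≡ L`, `M := L·T`: an extending solution is bounded on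
  `[0,T) × ℝ³` (`FastClassSqueeze.bounded_of_hasSmoothExtensionPast`: Tao 2013 Cor. 11.1 on the closed
  slab + Sobolev), hence has bounded velocity gradient `‖Du‖ ≤ L` there (landed stub
  `stub_fderiv_bound_of_velocity_bound`), and the near-taut compression rate of a `C¹` slice with
  `‖Du(s)‖ ≤ L` is `≤ L` (landed stub `stub_nearTautCompression_le_of_fderiv_le`).
* `tautCompressionIntegrable_of_noBlowup` — consequently K1 FOLLOWS from the no-blow-up statement for
  this class (the hypothesis of `TypeICertificateLadder.NoBlowupToClay`, i.e. Clay (A) packaged as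
  continuation): K1 is a necessary condition for regularity, unconditionally (the refuter's
  `CruxAttack.crux_of_navierStokesRegularity` had this modulo the two dictionary facts now proved).
* `typeIBlowup_endgame_of_noTypeIBlowup`, `nonTypeIBlowup_endgame_of_noTypeII` — the two singular
  regimes of the birth skeleton (a solution of the class that does NOT extend past `T`, with resp.
  without the Type-I rate at `T`) are EMPTY under the open items `TypeICertificateLadder.NoTypeIBlowup`
  (stmt-NavierStokesRegularity-1217) resp. `TypeICertificateLadder.NoTypeII`
  (stmt-NavierStokesRegularity-0056); so the registered stubs `stub_typeIBlowup_endgame` /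
  `stub_nonTypeIBlowup_endgame` of the reshaped skeleton are implied by those items verbatim.
* `stub_conclusion_of_hasSmoothExtensionPast` — the registered stub of the reshaped birth skeleton
  (regular regime), literally `conclusion_of_hasSmoothExtensionPast`.

No statement of the route is asserted; the open content of K1 is thereby located exactly at
`NoTypeIBlowup ∧ NoTypeII` (= no blow-up in the class), split by the rate at `T`.
-/

noncomputable section

open MeasureTheory Set
open Literature.Analysis.FluidPDE

namespace Summit.NavierStokesRegularity.NavierStokesRegularity.Theorems.TautCompressionIntegrable.Birth

set_option linter.dupNamespace false

/-- **The regular regime of K1.** If a classical solution of unforced Navier–Stokes on `ℝ³ × [0,T)`,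
Leray–Hopf on `[0,T]` from a rapidly decaying datum, extends classically past `T`, then for every
level `g` the near-taut compression rate `Λ_g(s)` is bounded on `(0,T)` by a constant `L ≥ 0`
(`Φ :≡ L`, `∫⁻_(0,T) Φ = L·T`): the extension makes `u` bounded on `[0,T) × ℝ³`
(`FastClassSqueeze.bounded_of_hasSmoothExtensionPast`), bounded velocity gives bounded gradient
(`stub_fderiv_bound_of_velocity_bound`), and the static loop-space bound
(`stub_nearTautCompression_le_of_fderiv_le`) applies to each `C¹` slice `u s`. -/
theorem conclusion_of_hasSmoothExtensionPast {ν T : ℝ} (hν : 0 < ν) (hT : 0 < T)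
    {u : ℝ → (EuclideanSpace ℝ (Fin 3)) → (EuclideanSpace ℝ (Fin 3))} {p : ℝ → (EuclideanSpace ℝ (Fin 3)) → ℝ} (hcl : IsClassicalNSSolutionOn (Set.Ico 0 T) ν 0 u p)
    (hLH : IsLerayHopfOn T ν 0 (u 0) u) (hdec : HasRapidSpatialDecay (u 0))
    (hext : HasSmoothExtensionPast ν 0 u T) (g : ℝ) :
    ∃ (Φ : ℝ → ℝ) (M : ℝ), Measurable Φ ∧ 0 ≤ M ∧
      (∀ s ∈ Set.Ioo 0 T, (⨅ ε : {ε : ℝ // 0 < ε}, sSup {k : ℝ | ∃ γ : ℝ → EuclideanSpace ℝ (Fin 3),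
        Literature.Analysis.FluidPDE.IsC1Loop γ ∧ g ≤ |Literature.Analysis.FluidPDE.circulation (u s) γ| ∧
        ENNReal.ofReal (∫ σ in (0:ℝ)..1, ‖deriv γ σ‖) ≤
          (⨅ (γ' : ℝ → EuclideanSpace ℝ (Fin 3)) (_ : Literature.Analysis.FluidPDE.IsC1Loop γ' ∧
            g ≤ |Literature.Analysis.FluidPDE.circulation (u s) γ'|), ENNReal.ofReal (∫ σ in (0:ℝ)..1, ‖deriv γ' σ‖)) +
          ENNReal.ofReal (ε : ℝ) ∧
        k = ((∫ σ in (0:ℝ)..1, -(inner ℝ (deriv γ σ) (fderiv ℝ (u s) (γ σ) (deriv γ σ))) / ‖deriv γ σ‖) /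
          (∫ σ in (0:ℝ)..1, ‖deriv γ σ‖))}) ≤ Φ s) ∧
      (∫⁻ s in Set.Ioo 0 T, ENNReal.ofReal (Φ s)) ≤ ENNReal.ofReal M := by
  have hB := FastClassSqueeze.bounded_of_hasSmoothExtensionPast ν T hν hT u p hcl hLH hdec hext
  obtain ⟨L, hL0, hL⟩ := stub_fderiv_bound_of_velocity_bound ν T hν hT u p hcl hLH hdec hB
  refine ⟨fun _ => L, L * T, measurable_const, mul_nonneg hL0 hT.le, ?_, ?_⟩
  · intro s hs
    have hs' : s ∈ Set.Ico 0 T := ⟨hs.1.le, hs.2⟩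
    have hC1 : ContDiff ℝ 1 (u s) := (hcl.contDiff_velocity hs').of_le (by norm_cast)
    exact stub_nearTautCompression_le_of_fderiv_le (u s) L hC1 hL0 (hL s hs') g
  · show (∫⁻ _ in Set.Ioo 0 T, ENNReal.ofReal L) ≤ ENNReal.ofReal (L * T)
    rw [setLIntegral_const, Real.volume_Ioo, sub_zero, ← ENNReal.ofReal_mul hL0]

/-- **K1 is a necessary condition for regularity.** If every classical solution of unforced
Navier–Stokes on `ℝ³ × [0,T)` that is Leray–Hopf on `[0,T]` from a rapidly decaying datum extends
classically past `T` (the no-blow-up statement for the class, hypothesis of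
`TypeICertificateLadder.NoBlowupToClay`), then `TautCompressionIntegrable` holds
(`conclusion_of_hasSmoothExtensionPast` at every solution and level). -/
theorem tautCompressionIntegrable_of_noBlowup
    (hNB : ∀ (ν T : ℝ), 0 < ν → 0 < T → ∀ (u : ℝ → (EuclideanSpace ℝ (Fin 3)) → (EuclideanSpace ℝ (Fin 3))) (p : ℝ → (EuclideanSpace ℝ (Fin 3)) → ℝ),
      IsClassicalNSSolutionOn (Set.Ico 0 T) ν 0 u p → IsLerayHopfOn T ν 0 (u 0) u →
      HasRapidSpatialDecay (u 0) → HasSmoothExtensionPast ν 0 u T) :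
    Summit.NavierStokesRegularity.NavierStokesRegularity.Theses.TautLoopKelvin.TautCompressionIntegrable := by
  intro ν T hν hT u p hcl hLH hdec g _hg
  exact conclusion_of_hasSmoothExtensionPast hν hT hcl hLH hdec (hNB ν T hν hT u p hcl hLH hdec) g

/-- **The Type-I singular regime is empty under `NoTypeIBlowup` (stmt-NavierStokesRegularity-1217).**
The registered stub `stub_typeIBlowup_endgame` of the reshaped birth skeleton (the conclusion of K1
for a solution of the class that does not extend past `T` but has the Type-I rate there) follows
from the open item `TypeICertificateLadder.NoTypeIBlowup` verbatim: that item continues every such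
solution past `T`, contradicting the non-extension hypothesis. -/
theorem typeIBlowup_endgame_of_noTypeIBlowup
    (hN : Summit.NavierStokesRegularity.NavierStokesRegularity.Theses.TypeICertificateLadder.NoTypeIBlowup) :
    ∀ (ν T : ℝ), 0 < ν → 0 < T →
      ∀ (u : ℝ → EuclideanSpace ℝ (Fin 3) → EuclideanSpace ℝ (Fin 3)) (p : ℝ → EuclideanSpace ℝ (Fin 3) → ℝ),
      Literature.Analysis.FluidPDE.IsClassicalNSSolutionOn (Set.Ico 0 T) ν 0 u p →
      Literature.Analysis.FluidPDE.IsLerayHopfOn T ν 0 (u 0) u →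
      Literature.Analysis.FluidPDE.HasRapidSpatialDecay (u 0) →
      ¬ Literature.Analysis.FluidPDE.HasSmoothExtensionPast ν 0 u T →
      Literature.Analysis.FluidPDE.IsTypeIBlowup u T →
      ∀ g : ℝ, 0 < g → ∃ (Φ : ℝ → ℝ) (M : ℝ), Measurable Φ ∧ 0 ≤ M ∧
        (∀ s ∈ Set.Ioo 0 T, (⨅ ε : {ε : ℝ // 0 < ε}, sSup {k : ℝ | ∃ γ : ℝ → EuclideanSpace ℝ (Fin 3),
          Literature.Analysis.FluidPDE.IsC1Loop γ ∧ g ≤ |Literature.Analysis.FluidPDE.circulation (u s) γ| ∧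
          ENNReal.ofReal (∫ σ in (0:ℝ)..1, ‖deriv γ σ‖) ≤
            (⨅ (γ' : ℝ → EuclideanSpace ℝ (Fin 3)) (_ : Literature.Analysis.FluidPDE.IsC1Loop γ' ∧
              g ≤ |Literature.Analysis.FluidPDE.circulation (u s) γ'|), ENNReal.ofReal (∫ σ in (0:ℝ)..1, ‖deriv γ' σ‖)) +
            ENNReal.ofReal (ε : ℝ) ∧
          k = ((∫ σ in (0:ℝ)..1, -(inner ℝ (deriv γ σ) (fderiv ℝ (u s) (γ σ) (deriv γ σ))) / ‖deriv γ σ‖) /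
            (∫ σ in (0:ℝ)..1, ‖deriv γ σ‖))}) ≤ Φ s) ∧
        (∫⁻ s in Set.Ioo 0 T, ENNReal.ofReal (Φ s)) ≤ ENNReal.ofReal M := by
  intro ν T hν hT u p hcl hLH hdec hmax hI _g _hg
  exact absurd (hN ν T hν hT u p hcl hLH hdec hI) hmax

/-- **The non-Type-I singular regime is empty under `NoTypeII` (stmt-NavierStokesRegularity-0056).**
The registered stub `stub_nonTypeIBlowup_endgame` of the reshaped birth skeleton (the conclusion of
K1 for a solution of the class that does not extend past `T` and lacks the Type-I rate there) follows
from the open item `TypeICertificateLadder.NoTypeII` verbatim: a non-extending classical solution is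
maximal (`IsMaximalSmoothSolution`), so that item forces the Type-I rate, contradicting the
hypothesis. -/
theorem nonTypeIBlowup_endgame_of_noTypeII
    (hN : Summit.NavierStokesRegularity.NavierStokesRegularity.Theses.TypeICertificateLadder.NoTypeII) :
    ∀ (ν T : ℝ), 0 < ν → 0 < T →
      ∀ (u : ℝ → EuclideanSpace ℝ (Fin 3) → EuclideanSpace ℝ (Fin 3)) (p : ℝ → EuclideanSpace ℝ (Fin 3) → ℝ),
      Literature.Analysis.FluidPDE.IsClassicalNSSolutionOn (Set.Ico 0 T) ν 0 u p →
      Literature.Analysis.FluidPDE.IsLerayHopfOn T ν 0 (u 0) u →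
      Literature.Analysis.FluidPDE.HasRapidSpatialDecay (u 0) →
      ¬ Literature.Analysis.FluidPDE.HasSmoothExtensionPast ν 0 u T →
      ¬ Literature.Analysis.FluidPDE.IsTypeIBlowup u T →
      ∀ g : ℝ, 0 < g → ∃ (Φ : ℝ → ℝ) (M : ℝ), Measurable Φ ∧ 0 ≤ M ∧
        (∀ s ∈ Set.Ioo 0 T, (⨅ ε : {ε : ℝ // 0 < ε}, sSup {k : ℝ | ∃ γ : ℝ → EuclideanSpace ℝ (Fin 3),
          Literature.Analysis.FluidPDE.IsC1Loop γ ∧ g ≤ |Literature.Analysis.FluidPDE.circulation (u s) γ| ∧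
          ENNReal.ofReal (∫ σ in (0:ℝ)..1, ‖deriv γ σ‖) ≤
            (⨅ (γ' : ℝ → EuclideanSpace ℝ (Fin 3)) (_ : Literature.Analysis.FluidPDE.IsC1Loop γ' ∧
              g ≤ |Literature.Analysis.FluidPDE.circulation (u s) γ'|), ENNReal.ofReal (∫ σ in (0:ℝ)..1, ‖deriv γ' σ‖)) +
            ENNReal.ofReal (ε : ℝ) ∧
          k = ((∫ σ in (0:ℝ)..1, -(inner ℝ (deriv γ σ) (fderiv ℝ (u s) (γ σ) (deriv γ σ))) / ‖deriv γ σ‖) /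
            (∫ σ in (0:ℝ)..1, ‖deriv γ σ‖))}) ≤ Φ s) ∧
        (∫⁻ s in Set.Ioo 0 T, ENNReal.ofReal (Φ s)) ≤ ENNReal.ofReal M := by
  intro ν T hν hT u p hcl hLH hdec hmax hnI _g _hg
  exact absurd (hN ν T hν hT u p ⟨hcl, hmax⟩ hLH hdec) hnI

/-- **Registered stub `stub_conclusion_of_hasSmoothExtensionPast` (reshaped birth skeleton, regular
regime).** For a classical solution of unforced Navier–Stokes on `ℝ³ × [0,T)`, Leray–Hopf on `[0,T]`
from a rapidly decaying datum, which extends classically past `T`, the conclusion of K1 holds at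
every level `g > 0` (`conclusion_of_hasSmoothExtensionPast`). -/
theorem stub_conclusion_of_hasSmoothExtensionPast :
    ∀ (ν T : ℝ), 0 < ν → 0 < T →
      ∀ (u : ℝ → EuclideanSpace ℝ (Fin 3) → EuclideanSpace ℝ (Fin 3)) (p : ℝ → EuclideanSpace ℝ (Fin 3) → ℝ),
      Literature.Analysis.FluidPDE.IsClassicalNSSolutionOn (Set.Ico 0 T) ν 0 u p →
      Literature.Analysis.FluidPDE.IsLerayHopfOn T ν 0 (u 0) u →
      Literature.Analysis.FluidPDE.HasRapidSpatialDecay (u 0) →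
      Literature.Analysis.FluidPDE.HasSmoothExtensionPast ν 0 u T →
      ∀ g : ℝ, 0 < g → ∃ (Φ : ℝ → ℝ) (M : ℝ), Measurable Φ ∧ 0 ≤ M ∧
        (∀ s ∈ Set.Ioo 0 T, (⨅ ε : {ε : ℝ // 0 < ε}, sSup {k : ℝ | ∃ γ : ℝ → EuclideanSpace ℝ (Fin 3),
          Literature.Analysis.FluidPDE.IsC1Loop γ ∧ g ≤ |Literature.Analysis.FluidPDE.circulation (u s) γ| ∧
          ENNReal.ofReal (∫ σ in (0:ℝ)..1, ‖deriv γ σ‖) ≤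
            (⨅ (γ' : ℝ → EuclideanSpace ℝ (Fin 3)) (_ : Literature.Analysis.FluidPDE.IsC1Loop γ' ∧
              g ≤ |Literature.Analysis.FluidPDE.circulation (u s) γ'|), ENNReal.ofReal (∫ σ in (0:ℝ)..1, ‖deriv γ' σ‖)) +
            ENNReal.ofReal (ε : ℝ) ∧
          k = ((∫ σ in (0:ℝ)..1, -(inner ℝ (deriv γ σ) (fderiv ℝ (u s) (γ σ) (deriv γ σ))) / ‖deriv γ σ‖) /
            (∫ σ in (0:ℝ)..1, ‖deriv γ σ‖))}) ≤ Φ s) ∧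
        (∫⁻ s in Set.Ioo 0 T, ENNReal.ofReal (Φ s)) ≤ ENNReal.ofReal M :=
  fun _ν _T hν hT _u _p hcl hLH hdec hext g _hg =>
    conclusion_of_hasSmoothExtensionPast hν hT hcl hLH hdec hext g

end Summit.NavierStokesRegularity.NavierStokesRegularity.Theorems.TautCompressionIntegrable.Birth

end
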